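import Summits.ValiantsHypothesis.ValiantsHypothesis.Theorems.KPlusLogSqLawTropicalBSymmetry
import Summits.ValiantsHypothesis.ValiantsHypothesis.Theorems.LacunarySymmetroidMatrixDescartesCensusTropicalKLawSlopes
import Summits.ValiantsHypothesis.ValiantsHypothesis.Theorems.KPlusLogSqLawTropicalBSplitDefs

/-!
# Route `KPlusLogSqLaw`, crux `TropicalB` — designs with a SYMMETRY of small index: few dominant permutations

HONEST FRAMING.  Helper toward the registered stubs `stub_tropThin` / `stub_tropFat` of
`Cruxes/TropicalB/Lines/birth.lean` (crux `Summit.ValiantsHypothesis.ValiantsHypothesis.Theses.KPlusLogSqLaw.TropicalB`,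
ledger item `stmt-ValiantsHypothesis-19771`, route `KPlusLogSqLaw`; cell `pub-symmetroid`, seat `val-sym-trop-p3`,
2026-08-26; desk docket D1a′ «a visited-permutation bound on a class where ALL-STATES is exponential», R1349/R1351).
A SECTOR theorem of an OPEN conjecture: nothing here bounds `TropicalB` for general designs, and nothing bears on
`KPlusLogSqLaw`, `MatrixDescartes` or `VP ≠ VNP`.

THE SECTOR.  A design `(d, v, ε)` of format `(m, K)` is SYMMETRIC under a pair of relabelings `(α, β)` of rows and
columns if `v (α a) (β b) l = v a b l` and `ε (α a) (β b) l = ε a b l`.  By val-sym-trop-p2's symmetry principle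
(`…TropicalBSymmetry.isDominant_fixed_of_symmetry'`) every dominant term `(σ, λ)` is FIXED: `α σ β⁻¹ = σ`, `λ ∘ β⁻¹ = λ`.
A fixed term satisfies `σ (βʲ t) = αʲ (σ t)` and `λ (βʲ t) = λ t` (`apply_pow_of_fixed`, `class_pow_of_fixed`), so it is
DETERMINED by its restriction to any set `T` of columns meeting every forward `β`-orbit.  Hence (no condition on the
support — it may be full, so the all-states count of the column split is exponential):

* `card_le_pow_of_symmetry` / `chain_succ_le_pow_of_symmetry` / `designRowD_of_symmetry` : every injective family of
  dominant terms — in particular every sign-alternating or consecutive-distinct dominant chain — has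
  `n + 1 ≤ m^|T| · K^|T|` terms: at most `m^|T|` distinct dominant PERMUTATIONS ever occur;
* `symmetricOrbits_kPlusLogSq` : if `|T| ≤ log₂ m` (a symmetry of index at most `log₂ m`), the crux's inequality holds
  with the absolute constant `C = 4` (for `K > m` this is the fat end `tropRootLawAt_fatEnd`); K-ADAPTIVE form
  `symmetricOrbits_kPlusLogSq_adaptive` : `|T|·(log₂ m + 1) ≤ K + log₂² m` gives `C = 2` (index up to `≈ K / log₂ m`);
* the PERIOD-`q` CIRCULANT instance `periodic_kPlusLogSq` : `α = β = (finRotate m)^q` (translation of rows and columns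
  by `q`), `T = [0, q)`: designs with `v (a+q) (b+q) l = v a b l`, `ε` likewise, `0 < q ≤ log₂ m`, satisfy TB's inequality
  with `C = 4` (`periodic_kPlusLogSq_adaptive` : `q·(log₂ m + 1) ≤ K + log₂² m`, `C = 2`).  (`q = 1` is val-sym-trop-p2's
  circulant sector, where the sharper `n ≤ K − 1` holds.)

HONEST RANGE (desk R1356 (ii)).  This is an OBJECT-SYMMETRY sector: designs with a non-trivial symmetry `(α, β)` are a
measure-zero family among all designs of a format (SHIFT-THREE's column price, for instance, breaks every translation
symmetry), and the bound comes from the symmetry, not from the support.  For GENERAL designs a visited-permutation law of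
this strength IS the crux `TropicalB` itself (no symmetry, no orbit representatives); nothing here says anything about it.

[folklore: uniqueness of an optimum ⇒ invariance under the automorphism group; orbit counting]
-/

set_option linter.dupNamespace false
set_option autoImplicit false

namespace Summit.ValiantsHypothesis.ValiantsHypothesis.Theorems.KPlusLogSqLaw

open Summit.ValiantsHypothesis.ValiantsHypothesis.Theorems.MatrixDescartes.Negative
open Summit.ValiantsHypothesis.ValiantsHypothesis.Theorems.LacunarySymmetroidMatrixDescartes
open Summit.ValiantsHypothesis.ValiantsHypothesis.Theorems.LacunarySymmetroidMatrixDescartes.TropicalCensus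
open scoped BigOperators
open Finset

/-! ## 1. Fixed terms are determined on orbit representatives -/

section Orbits

variable {m K : ℕ}

/-- iterating the fixed-point equation of the permutation part: `σ (βʲ t) = αʲ (σ t)`. [folklore] -/
theorem apply_pow_of_fixed (α β σ : Equiv.Perm (Fin m)) (h : α * σ * β⁻¹ = σ) (j : ℕ) (t : Fin m) :
    σ ((β ^ j) t) = (α ^ j) (σ t) := by
  have h' : ∀ x, σ (β x) = α (σ x) := by
    intro x
    have := congrArg (fun τ : Equiv.Perm (Fin m) => τ (β x)) h
    simpa using this.symm
  induction j generalizing t with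
  | zero => simp
  | succ j ih => rw [pow_succ', pow_succ', Equiv.Perm.mul_apply, Equiv.Perm.mul_apply, h', ih]

/-- iterating the fixed-point equation of the class part: `λ (βʲ t) = λ t`. [folklore] -/
theorem class_pow_of_fixed (β : Equiv.Perm (Fin m)) (μ : Fin m → Fin K) (h : (fun j => μ (β.symm j)) = μ)
    (j : ℕ) (t : Fin m) : μ ((β ^ j) t) = μ t := by
  have h' : ∀ x, μ (β x) = μ x := by
    intro x
    have := congrFun h (β x)
    simp only [Equiv.symm_apply_apply] at this
    exact this.symm
  induction j generalizing t with
  | zero => simp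
  | succ j ih => rw [pow_succ', Equiv.Perm.mul_apply, h', ih]

/-- **Few dominant terms under a symmetry (core).**  If a design is symmetric under `(α, β)` and `T` meets every
forward `β`-orbit, then every INJECTIVE family of dominant terms indexed by `Fin (n+1)` has `n + 1 ≤ m^|T| · K^|T|`:
dominant terms are `(α, β)`-fixed (val-sym-trop-p2's `isDominant_fixed_of_symmetry'`), and a fixed term is determined
by its restriction to `T`. [folklore] -/
theorem card_le_pow_of_symmetry (d : Fin K → ℕ) (v ε : Fin m → Fin m → Fin K → ℤ)
    (α β : Equiv.Perm (Fin m)) (hv : ∀ a b l, v (α a) (β b) l = v a b l) (hε : ∀ a b l, ε (α a) (β b) l = ε a b l)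
    (T : Finset (Fin m)) (hT : ∀ b : Fin m, ∃ t ∈ T, ∃ j : ℕ, (β ^ j) t = b)
    {n : ℕ} (θ : Fin (n + 1) → ℤ) (p : Fin (n + 1) → Equiv.Perm (Fin m) × (Fin m → Fin K))
    (hdom : ∀ k, IsDominant d v ε (θ k) (p k)) (hinj : Function.Injective p) :
    n + 1 ≤ m ^ T.card * K ^ T.card := by
  classical
  have hfix : ∀ k, α * (p k).1 * β⁻¹ = (p k).1 ∧ (fun j => (p k).2 (β.symm j)) = (p k).2 := fun k =>
    isDominant_fixed_of_symmetry' d v ε α β hv hε (θ k) (p k).1 (p k).2 (hdom k)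
  -- restriction to `T`
  let F : Fin (n + 1) → (T → Fin m) × (T → Fin K) := fun k => (fun t => (p k).1 t, fun t => (p k).2 t)
  have hF : Function.Injective F := by
    intro k k' hkk
    have h1 : ∀ t ∈ T, (p k).1 t = (p k').1 t := fun t ht => by
      have := congrArg (fun G : (T → Fin m) × (T → Fin K) => G.1 ⟨t, ht⟩) hkk
      simpa [F] using this
    have h2 : ∀ t ∈ T, (p k).2 t = (p k').2 t := fun t ht => by
      have := congrArg (fun G : (T → Fin m) × (T → Fin K) => G.2 ⟨t, ht⟩) hkk
      simpa [F] using this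
    apply hinj
    refine Prod.ext (Equiv.ext fun b => ?_) (funext fun b => ?_)
    · obtain ⟨t, ht, j, rfl⟩ := hT b
      rw [apply_pow_of_fixed α β _ (hfix k).1, apply_pow_of_fixed α β _ (hfix k').1, h1 t ht]
    · obtain ⟨t, ht, j, rfl⟩ := hT b
      rw [class_pow_of_fixed β _ (hfix k).2, class_pow_of_fixed β _ (hfix k').2, h2 t ht]
  have hcard := Fintype.card_le_of_injective F hF
  simpa [Fintype.card_fin, Fintype.card_prod, Fintype.card_fun, Fintype.card_coe] using hcard

/-- **Few dominant terms under a symmetry (signed chains).**  Along every sign-alternating dominant chain of a design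
symmetric under `(α, β)`, `n + 1 ≤ m^|T| · K^|T|` — at most `m^|T|` distinct dominant PERMUTATIONS ever occur. [folklore] -/
theorem chain_succ_le_pow_of_symmetry (d : Fin K → ℕ) (v ε : Fin m → Fin m → Fin K → ℤ)
    (α β : Equiv.Perm (Fin m)) (hv : ∀ a b l, v (α a) (β b) l = v a b l) (hε : ∀ a b l, ε (α a) (β b) l = ε a b l)
    (T : Finset (Fin m)) (hT : ∀ b : Fin m, ∃ t ∈ T, ∃ j : ℕ, (β ^ j) t = b)
    {n : ℕ} (θ : Fin (n + 1) → ℤ) (p : Fin (n + 1) → Equiv.Perm (Fin m) × (Fin m → Fin K))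
    (hθ : StrictMono θ) (hdom : ∀ k, IsDominant d v ε (θ k) (p k))
    (halt : ∀ k : Fin n, termSign ε (p k.castSucc) * termSign ε (p k.succ) < 0) :
    n + 1 ≤ m ^ T.card * K ^ T.card :=
  card_le_pow_of_symmetry d v ε α β hv hε T hT θ p hdom (stub_dominantInjective m K d v ε n θ p hθ hdom halt)

/-- **Few dominant terms under a symmetry (unsigned row bound).**  A design symmetric under `(α, β)` has
`DesignRowD d v ε (m^|T| · K^|T| − 1)` (val-sym-trop-p1's unsigned row: consecutive-distinct dominant chains). [folklore] -/
theorem designRowD_of_symmetry (d : Fin K → ℕ) (v ε : Fin m → Fin m → Fin K → ℤ)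
    (α β : Equiv.Perm (Fin m)) (hv : ∀ a b l, v (α a) (β b) l = v a b l) (hε : ∀ a b l, ε (α a) (β b) l = ε a b l)
    (T : Finset (Fin m)) (hT : ∀ b : Fin m, ∃ t ∈ T, ∃ j : ℕ, (β ^ j) t = b) :
    DesignRowD d v ε (m ^ T.card * K ^ T.card - 1) := by
  intro n θ p hθ hdom hne
  have := card_le_pow_of_symmetry d v ε α β hv hε T hT θ p hdom (injective_of_chainD d v ε θ p hθ hdom hne)
  omega

/-- arithmetic: `m^r · K^r ≤ 2^(4·log₂² m)·…` when `r ≤ log₂ m` and `K ≤ m`. [folklore] -/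
theorem pow_mul_pow_le_two_pow (m K r : ℕ) (hr : r ≤ Nat.log 2 m) (hK : K ≤ m) :
    m ^ r * K ^ r ≤ 2 ^ (4 * Nat.log 2 m ^ 2) := by
  set L := Nat.log 2 m with hL
  have hm : m ≤ 2 ^ (L + 1) := (Nat.lt_pow_succ_log_self (b := 2) (by norm_num) m).le
  calc m ^ r * K ^ r ≤ m ^ r * m ^ r := Nat.mul_le_mul_left _ (Nat.pow_le_pow_left hK r)
    _ ≤ (2 ^ (L + 1)) ^ r * (2 ^ (L + 1)) ^ r :=
        Nat.mul_le_mul (Nat.pow_le_pow_left hm r) (Nat.pow_le_pow_left hm r)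
    _ = 2 ^ (2 * ((L + 1) * r)) := by rw [← pow_mul, ← pow_add]; ring_nf
    _ ≤ 2 ^ (4 * L ^ 2) := Nat.pow_le_pow_right (by norm_num) (by
        rcases Nat.eq_zero_or_pos L with h0 | h0
        · have : r = 0 := by omega
          subst this; simp [h0]
        · nlinarith)

/-- **The `K + log² m` law for designs with a symmetry of index `≤ log₂ m` (`C = 4`).**  If a design of format `(m, K)`
is symmetric under `(α, β)` and some set `T` of at most `log₂ m` columns meets every forward `β`-orbit, every
sign-alternating dominant chain has at most `2^(4·(K + (log₂ m)²))` breakpoints (`K ≤ m`: the orbit count; `m < K`: the fat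
end `tropRootLawAt_fatEnd`).  HONEST RANGE: a restricted class (full supports allowed). [folklore] -/
theorem symmetricOrbits_kPlusLogSq {m K : ℕ} (d : Fin K → ℕ) (v ε : Fin m → Fin m → Fin K → ℤ)
    (α β : Equiv.Perm (Fin m)) (hv : ∀ a b l, v (α a) (β b) l = v a b l) (hε : ∀ a b l, ε (α a) (β b) l = ε a b l)
    (T : Finset (Fin m)) (hT : ∀ b : Fin m, ∃ t ∈ T, ∃ j : ℕ, (β ^ j) t = b) (hTcard : T.card ≤ Nat.log 2 m)
    (hε1 : ∀ i j l, (ε i j l).natAbs ≤ 1)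
    {n : ℕ} (θ : Fin (n + 1) → ℤ) (p : Fin (n + 1) → Equiv.Perm (Fin m) × (Fin m → Fin K))
    (hθ : StrictMono θ) (hdom : ∀ k, IsDominant d v ε (θ k) (p k))
    (halt : ∀ k : Fin n, termSign ε (p k.castSucc) * termSign ε (p k.succ) < 0) :
    n ≤ 2 ^ (4 * (K + Nat.log 2 m ^ 2)) := by
  rcases le_or_gt K m with hK | hK
  · have h1 := chain_succ_le_pow_of_symmetry d v ε α β hv hε T hT θ p hθ hdom halt
    have h2 := pow_mul_pow_le_two_pow m K T.card hTcard hK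
    have h3 : 2 ^ (4 * Nat.log 2 m ^ 2) ≤ 2 ^ (4 * (K + Nat.log 2 m ^ 2)) :=
      Nat.pow_le_pow_right (by norm_num) (by nlinarith)
    omega
  · have h := tropRootLawAt_fatEnd (m := m) (K := K) hK.le d v ε n θ p hε1 hθ hdom halt
    exact h.trans (Nat.pow_le_pow_right (by norm_num) (by nlinarith))

/-- arithmetic, K-adaptive: `m^r · K^r ≤ 2^(2(K + log₂² m))` when `r·(log₂ m + 1) ≤ K + log₂² m` and `K ≤ m`. [folklore] -/
theorem pow_mul_pow_le_two_pow_adaptive (m K r : ℕ) (hr : r * (Nat.log 2 m + 1) ≤ K + Nat.log 2 m ^ 2)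
    (hK : K ≤ m) : m ^ r * K ^ r ≤ 2 ^ (2 * (K + Nat.log 2 m ^ 2)) := by
  set L := Nat.log 2 m with hL
  have hm : m ≤ 2 ^ (L + 1) := (Nat.lt_pow_succ_log_self (b := 2) (by norm_num) m).le
  calc m ^ r * K ^ r ≤ m ^ r * m ^ r := Nat.mul_le_mul_left _ (Nat.pow_le_pow_left hK r)
    _ ≤ (2 ^ (L + 1)) ^ r * (2 ^ (L + 1)) ^ r :=
        Nat.mul_le_mul (Nat.pow_le_pow_left hm r) (Nat.pow_le_pow_left hm r)
    _ = 2 ^ (2 * ((L + 1) * r)) := by rw [← pow_mul, ← pow_add]; ring_nf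
    _ ≤ 2 ^ (2 * (K + L ^ 2)) := Nat.pow_le_pow_right (by norm_num) (by nlinarith)

/-- **K-ADAPTIVE form: symmetries of index up to `(K + log₂² m)/(log₂ m + 1)`.**  If a design of format `(m, K)` is
symmetric under `(α, β)` and some set `T` of columns meeting every forward `β`-orbit satisfies
`|T|·(log₂ m + 1) ≤ K + log₂² m`, every sign-alternating dominant chain has at most `2^(2·(K + (log₂ m)²))` breakpoints.
In the fat regime this admits symmetry index up to `≈ K / log₂ m`.  HONEST RANGE: a restricted class. [folklore] -/
theorem symmetricOrbits_kPlusLogSq_adaptive {m K : ℕ} (d : Fin K → ℕ) (v ε : Fin m → Fin m → Fin K → ℤ)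
    (α β : Equiv.Perm (Fin m)) (hv : ∀ a b l, v (α a) (β b) l = v a b l) (hε : ∀ a b l, ε (α a) (β b) l = ε a b l)
    (T : Finset (Fin m)) (hT : ∀ b : Fin m, ∃ t ∈ T, ∃ j : ℕ, (β ^ j) t = b)
    (hTcard : T.card * (Nat.log 2 m + 1) ≤ K + Nat.log 2 m ^ 2)
    (hε1 : ∀ i j l, (ε i j l).natAbs ≤ 1)
    {n : ℕ} (θ : Fin (n + 1) → ℤ) (p : Fin (n + 1) → Equiv.Perm (Fin m) × (Fin m → Fin K))
    (hθ : StrictMono θ) (hdom : ∀ k, IsDominant d v ε (θ k) (p k))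
    (halt : ∀ k : Fin n, termSign ε (p k.castSucc) * termSign ε (p k.succ) < 0) :
    n ≤ 2 ^ (2 * (K + Nat.log 2 m ^ 2)) := by
  rcases le_or_gt K m with hK | hK
  · have h1 := chain_succ_le_pow_of_symmetry d v ε α β hv hε T hT θ p hθ hdom halt
    have h2 := pow_mul_pow_le_two_pow_adaptive m K T.card hTcard hK
    omega
  · have h := tropRootLawAt_fatEnd (m := m) (K := K) hK.le d v ε n θ p hε1 hθ hdom halt
    exact h.trans (Nat.pow_le_pow_right (by norm_num) (by nlinarith))

end Orbits

/-! ## 2. The period-`q` circulant instance -/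

section Periodic

variable {m K : ℕ}

/-- powers of `finRotate` act by addition as long as there is no wrap-around. [folklore] -/
theorem finRotate_pow_apply_of_lt (s : ℕ) : ∀ (x : Fin m) (h : (x : ℕ) + s < m),
    ((finRotate m) ^ s) x = ⟨(x : ℕ) + s, h⟩ := by
  induction s with
  | zero => intro x h; simp
  | succ s ih =>
    intro x h
    have h' : (x : ℕ) + s < m := by omega
    rw [pow_succ', Equiv.Perm.mul_apply, ih x h']
    cases m with
    | zero => exact absurd h (Nat.not_lt_zero _)
    | succ n =>
      rw [finRotate_apply]
      apply Fin.ext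
      rw [Fin.val_add_one_of_lt (by rw [Fin.lt_def, Fin.val_last]; dsimp only; omega)]
      dsimp only
      omega

/-- the columns `[0, q)` meet every forward orbit of the translation by `q` (`0 < q`): `b = ρ^(b / q) (b % q)`. [folklore] -/
theorem orbit_rep_of_period (q : ℕ) (hq : 0 < q) (b : Fin m) :
    ∃ t ∈ (univ : Finset (Fin m)).filter (fun x : Fin m => (x : ℕ) < q), ∃ j : ℕ, (((finRotate m) ^ q) ^ j) t = b := by
  have hbq : (b : ℕ) % q < m := lt_of_le_of_lt (Nat.mod_le _ _) b.isLt
  refine ⟨⟨(b : ℕ) % q, hbq⟩, mem_filter.mpr ⟨mem_univ _, Nat.mod_lt _ hq⟩, (b : ℕ) / q, ?_⟩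
  rw [← pow_mul]
  have h : ((⟨(b : ℕ) % q, hbq⟩ : Fin m) : ℕ) + q * ((b : ℕ) / q) < m := by
    simp only; rw [Nat.mod_add_div]; exact b.isLt
  rw [finRotate_pow_apply_of_lt (q * ((b : ℕ) / q)) _ h]
  apply Fin.ext
  simp only
  exact Nat.mod_add_div _ _

/-- the columns `[0, q)` are at most `q`. [folklore] -/
theorem card_filter_lt_le (q : ℕ) : ((univ : Finset (Fin m)).filter (fun x : Fin m => (x : ℕ) < q)).card ≤ q := by
  calc ((univ : Finset (Fin m)).filter (fun x : Fin m => (x : ℕ) < q)).card ≤ (range q).card := by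
        refine card_le_card_of_injOn (fun x : Fin m => (x : ℕ)) (fun x hx => ?_) (fun x _ y _ h => Fin.ext h)
        exact mem_coe.mpr (mem_range.mpr (mem_filter.mp (mem_coe.mp hx)).2)
    _ = q := card_range _

/-- **Period-`q` circulant designs (`0 < q ≤ log₂ m`) satisfy the `K + log² m` law with `C = 4`.**  If translating rows
and columns simultaneously by `q` (the permutation `(finRotate m)^q`) preserves valuations and signs, every
sign-alternating dominant chain has at most `2^(4·(K + (log₂ m)²))` breakpoints — although such designs may have full
support (exponentially many split states).  `q = 1`: val-sym-trop-p2's circulant sector (there `n ≤ K − 1`).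
HONEST RANGE: a restricted class. [folklore] -/
theorem periodic_kPlusLogSq {m K : ℕ} (q : ℕ) (hq : 0 < q) (hqL : q ≤ Nat.log 2 m)
    (d : Fin K → ℕ) (v ε : Fin m → Fin m → Fin K → ℤ)
    (hv : ∀ a b l, v (((finRotate m) ^ q) a) (((finRotate m) ^ q) b) l = v a b l)
    (hε : ∀ a b l, ε (((finRotate m) ^ q) a) (((finRotate m) ^ q) b) l = ε a b l)
    (hε1 : ∀ i j l, (ε i j l).natAbs ≤ 1)
    {n : ℕ} (θ : Fin (n + 1) → ℤ) (p : Fin (n + 1) → Equiv.Perm (Fin m) × (Fin m → Fin K))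
    (hθ : StrictMono θ) (hdom : ∀ k, IsDominant d v ε (θ k) (p k))
    (halt : ∀ k : Fin n, termSign ε (p k.castSucc) * termSign ε (p k.succ) < 0) :
    n ≤ 2 ^ (4 * (K + Nat.log 2 m ^ 2)) :=
  symmetricOrbits_kPlusLogSq d v ε _ _ hv hε _ (orbit_rep_of_period q hq) ((card_filter_lt_le q).trans hqL)
    hε1 θ p hθ hdom halt

/-- **Period-`q` circulant designs, K-adaptive form**: `0 < q` and `q·(log₂ m + 1) ≤ K + log₂² m` give the bound
`2^(2·(K + (log₂ m)²))` — periods up to `≈ K / log₂ m` in the fat regime. [folklore] -/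
theorem periodic_kPlusLogSq_adaptive {m K : ℕ} (q : ℕ) (hq : 0 < q) (hqK : q * (Nat.log 2 m + 1) ≤ K + Nat.log 2 m ^ 2)
    (d : Fin K → ℕ) (v ε : Fin m → Fin m → Fin K → ℤ)
    (hv : ∀ a b l, v (((finRotate m) ^ q) a) (((finRotate m) ^ q) b) l = v a b l)
    (hε : ∀ a b l, ε (((finRotate m) ^ q) a) (((finRotate m) ^ q) b) l = ε a b l)
    (hε1 : ∀ i j l, (ε i j l).natAbs ≤ 1)
    {n : ℕ} (θ : Fin (n + 1) → ℤ) (p : Fin (n + 1) → Equiv.Perm (Fin m) × (Fin m → Fin K))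
    (hθ : StrictMono θ) (hdom : ∀ k, IsDominant d v ε (θ k) (p k))
    (halt : ∀ k : Fin n, termSign ε (p k.castSucc) * termSign ε (p k.succ) < 0) :
    n ≤ 2 ^ (2 * (K + Nat.log 2 m ^ 2)) :=
  symmetricOrbits_kPlusLogSq_adaptive d v ε _ _ hv hε _ (orbit_rep_of_period q hq)
    ((Nat.mul_le_mul_right _ (card_filter_lt_le q)).trans hqK) hε1 θ p hθ hdom halt

end Periodic

end Summit.ValiantsHypothesis.ValiantsHypothesis.Theorems.KPlusLogSqLaw
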